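import Summits.QuantumFields.YangMills.Theorems.F4SubCurvatureDoorSubCurvatureClauseMixedTwoPoint
import Summits.QuantumFields.YangMills.Theorems.F4SubCurvatureDoorSubCurvatureClauseMixedAxisDomination
import Summits.QuantumFields.YangMills.Theorems.F4SubCurvatureDoorSubCurvatureClauseLatticeToAxisTools
import Summits.QuantumFields.YangMills.Theorems.F4SubCurvatureDoorSubCurvatureClauseLatticeToAxis
import HarnessLib

/-!
# Route `F4SubCurvatureDoor`, crux `SubCurvatureClause` ⟨stmt-QuantumFields-23763⟩ — `LatticeToAxis` in the SKELETON'S LETTER (single axis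
# order `(Q^θ, Q)`, no sign hypothesis on `B`)

Helper file (`--supports stmt-QuantumFields-23763 --as helper`; free-hands seat `ym-line-frs-p2` g19).  Definition-free, 0 sorry, standard axioms.
It proves the soft stub `LatticeToAxis` of the crux idea «rp-moebius-ladder» VERBATIM as typed in the ideator sketch (ym-idea-3 g24,
HOME `g24/Sketch.lean` rev 2 :107–123; requested in this letter by ym-idea-3 g25 for the skeleton of R527-ym (a)), with `axisG` unfolded:
under the door's hypotheses, if eventually along the subsequence `(2t)⁸ · lCC(Q^θ, Q, 2t) ≤ B` at every lattice time `2t` with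
`2t·a_k ∈ [u(1−θ), u(1+θ)]`, then the continuous representing kernel obeys `u⁸ |K(u e₀)| ≤ (1+θ)⁸/(1−θ)⁸ · B`.

Route («density swap», no order swap): the kernel `K` also represents the limit of the MIXED sums `Σ_z Cov_T(Q_{z₀}, Q^θ_{z₁}) F(a_k z)`
(✓`tendsto_mixed_of_offDiagLimitAlong`); the mixed weight is the mixed kernel `κ(z₀ − z₁)` (✓`mixedCov_translate`), which reflection positivity
dominates by the on-axis couplings in the `(Q^θ, Q)` order, `κ(s)² ≤ lCC(Q^θ,Q,2⌈n/2⌉)·lCC(Q^θ,Q,2⌊n/2⌋)` (✓`sq_mixedKernel_le_lcc_mul_lcc`); the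
window bounds give `|κ| ≤ B a_k⁸/(u(1−θ))⁸` on the pairs seen by a test function localised at `u e₀`, hence `‖S₁ 2 F‖ ≤ B/(u(1−θ))⁸ ∫‖F‖`
there, and ✓`abs_le_of_local_density_bound` concludes.  For `B < 0` the window hypothesis contradicts `lCC(Q^θ,Q,2t) ≥ 0` (lattice RP).

[cite: OsterwalderSeiler1978, §2]; [folklore; Glimm–Jaffe 1987 §6.1].

HONEST LABEL: a soft stub; the crux content ON the axis (`MoebiusRow`, `CrossoverDecay`) is untouched; ⟨23763⟩, ⟨23036⟩ open; the Yang–Mills mass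
gap is NOT proved; no summit is proved by a line.
-/

set_option autoImplicit false

noncomputable section

open scoped SchwartzMap BigOperators
open MeasureTheory Filter Topology Metric Set
open Literature.MathematicalPhysics.QuantumFieldTheory Literature.MathematicalPhysics.QuantumLattice
open Literature.MathematicalPhysics.AQFT
open Literature.Probability.LatticeModels (box Site mem_box)
open Summit.QuantumFields.YangMills.Cruxes.OSLegsFromFemtoAndGap.DlrCollarTransfer (dens torusE MomentBounds6)
open Summit.QuantumFields.YangMills.Cruxes.OSLegsAtWeakCouplingC.Sketch (tendsto_riemann_sum)
open Summit.QuantumFields.YangMills.Theorems.OSLegsFromFemtoAndGap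
open Summit.QuantumFields.YangMills.Theorems.ROT (IsLegScheme OffDiagLimitAlong)
open Summit.QuantumFields.YangMills.Theorems.NPointIsotropy.Negative (E4)
open Summit.QuantumFields.YangMills.Theorems.F4SubCurvatureDoorSubCurvatureClauseLatticeToAxisTools (abs_le_of_local_density_bound)
open Summit.QuantumFields.YangMills.Theorems.F4SubCurvatureDoorSubCurvatureClauseMixedTwoPoint (tendsto_mixed_of_offDiagLimitAlong)
open Summit.QuantumFields.YangMills.Theorems.F4SubCurvatureDoorSubCurvatureClauseMixedAxisDomination
  (mixedCov_translate sq_mixedKernel_le_lcc_mul_lcc)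
open Summit.QuantumFields.YangMills.Theorems.F4SubCurvatureDoorSubCurvatureClauseLatticeToAxis (smul_siteToE_sub_sub_single_apply_zero)

namespace Summit.QuantumFields.YangMills.Theorems.F4SubCurvatureDoorSubCurvatureClauseLatticeToAxisSingle

variable {G : Type} [Group G] [TopologicalSpace G] [IsTopologicalGroup G] [CompactSpace G]
  [MeasurableSpace G] [BorelSpace G]

/-! ## §1 The mixed weight under a two-sided window on `lCC(Q^θ, Q, ·)` alone -/

/-- **The mixed weight bounded through the window.**  On the odd torus `2L+1` at `β ≥ 0`, for a pair of sites `z` whose separation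
`s = z₀ − z₁` has time component `n` with `3 ≤ n ≤ L` and `14 ≤ L`, and `B ≥ 0`: if `(2⌈n/2⌉)⁸·lCC(Q^θ,Q,2⌈n/2⌉) ≤ B` and
`(2⌊n/2⌋)⁸·lCC(Q^θ,Q,2⌊n/2⌋) ≤ B`, then `|Cov_T(Q_{z₀}, Q^θ_{z₁})| ≤ B/(n−1)⁸`. [cite: OsterwalderSeiler1978, §2] -/
theorem abs_mixedWeight_le_of_window (r : LatticeRep G) {β : ℝ} (hβ : 0 ≤ β) {L : ℕ} (hL : 14 ≤ L) (z : Fin 2 → Site 4) (n : ℕ)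
    (hz0 : (z 0 - z 1) 0 = n) (hn3 : 3 ≤ n) (hnL : n ≤ L) {B : ℝ} (hB0 : 0 ≤ B)
    (h1 : ((2 * ((n + 1) / 2) : ℕ) : ℝ) ^ 8 *
        latticeConnectedCorr r.ρ β (2 * L + 1) r.curvature.timeReflect.F r.curvature.F (2 * ((n + 1) / 2)) ≤ B)
    (h2 : ((2 * (n / 2) : ℕ) : ℝ) ^ 8 *
        latticeConnectedCorr r.ρ β (2 * L + 1) r.curvature.timeReflect.F r.curvature.F (2 * (n / 2)) ≤ B) :
    |torusE G r β L (fun V => dens G r (z 0) V * dens G r (siteReflect (z 1)) (cfgReflect V)) -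
        torusE G r β L (dens G r (z 0)) * torusE G r β L (dens G r (siteReflect (z 1)))| ≤ B / ((n : ℝ) - 1) ^ 8 := by
  -- the mixed weight is the mixed kernel at `z₀ − z₁`
  have hκ : torusE G r β L (fun V => dens G r (z 0) V * dens G r (siteReflect (z 1)) (cfgReflect V)) -
      torusE G r β L (dens G r (z 0)) * torusE G r β L (dens G r (siteReflect (z 1))) =
      torusE G r β L (fun V => dens G r 0 (cfgReflect V) * dens G r (z 0 - z 1) V) -
        torusE G r β L (dens G r 0) * torusE G r β L (dens G r (z 0 - z 1)) := by
    have h := mixedCov_translate r β L (siteReflect (z 1)) (z 0)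
    rw [siteReflect_siteReflect] at h
    rw [← h, mul_comm (torusE G r β L (dens G r (z 0)))]
    congr 2
    funext V
    ring
  rw [hκ]
  -- axis domination in the `(Q^θ, Q)` order
  obtain ⟨hpos1, hpos2, hsq⟩ := sq_mixedKernel_le_lcc_mul_lcc r hβ L (n / 2) ((n + 1) / 2) (by omega) (by omega) (z 0 - z 1)
    (by rw [hz0]; push_cast; omega)
  set A₁ := latticeConnectedCorr r.ρ β (2 * L + 1) r.curvature.timeReflect.F r.curvature.F (2 * ((n + 1) / 2)) with hA₁
  set A₂ := latticeConnectedCorr r.ρ β (2 * L + 1) r.curvature.timeReflect.F r.curvature.F (2 * (n / 2)) with hA₂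
  have ht1 : (n : ℝ) - 1 ≤ ((2 * ((n + 1) / 2) : ℕ) : ℝ) := by
    have : n - 1 ≤ 2 * ((n + 1) / 2) := by omega
    have h' : ((n - 1 : ℕ) : ℝ) ≤ ((2 * ((n + 1) / 2) : ℕ) : ℝ) := by exact_mod_cast this
    rwa [Nat.cast_sub (by omega), Nat.cast_one] at h'
  have ht2 : (n : ℝ) - 1 ≤ ((2 * (n / 2) : ℕ) : ℝ) := by
    have : n - 1 ≤ 2 * (n / 2) := by omega
    have h' : ((n - 1 : ℕ) : ℝ) ≤ ((2 * (n / 2) : ℕ) : ℝ) := by exact_mod_cast this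
    rwa [Nat.cast_sub (by omega), Nat.cast_one] at h'
  have hm0 : 0 < (n : ℝ) - 1 := by
    have : (3 : ℝ) ≤ n := by exact_mod_cast hn3
    linarith
  set M : ℝ := ((n : ℝ) - 1) ^ 8 with hM
  have hM0 : 0 < M := by positivity
  have hA₁le : A₁ ≤ B / M := by
    have hp : 0 < ((2 * ((n + 1) / 2) : ℕ) : ℝ) ^ 8 := pow_pos (hm0.trans_le ht1) 8
    have h' : A₁ ≤ B / ((2 * ((n + 1) / 2) : ℕ) : ℝ) ^ 8 := by
      rw [le_div_iff₀ hp, mul_comm]; exact h1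
    refine h'.trans (div_le_div_of_nonneg_left hB0 hM0 ?_)
    exact pow_le_pow_left₀ hm0.le ht1 8
  have hA₂le : A₂ ≤ B / M := by
    have hp : 0 < ((2 * (n / 2) : ℕ) : ℝ) ^ 8 := pow_pos (hm0.trans_le ht2) 8
    have h' : A₂ ≤ B / ((2 * (n / 2) : ℕ) : ℝ) ^ 8 := by
      rw [le_div_iff₀ hp, mul_comm]; exact h2
    refine h'.trans (div_le_div_of_nonneg_left hB0 hM0 ?_)
    exact pow_le_pow_left₀ hm0.le ht2 8
  have hprod : A₁ * A₂ ≤ (B / M) ^ 2 := by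
    rw [sq]
    exact mul_le_mul hA₁le hA₂le hpos2 (div_nonneg hB0 hM0.le)
  exact abs_le_of_sq_le_sq (hsq.trans hprod) (div_nonneg hB0 hM0.le)

/-! ## §2 The two halves of the stub -/

/-- **The window is eventually inhabited, so a negative bound is absurd**: along an admissible leg scheme, if eventually every lattice time
`2t` with `2t·a_k ∈ [u(1−θ), u(1+θ)]` has `(2t)⁸·lCC(Q^θ,Q,2t) ≤ B`, then `0 ≤ B` (the window eventually contains an admissible time, where
`lCC(Q^θ,Q,2t) ≥ 0` by lattice reflection positivity). [cite: OsterwalderSeiler1978, §2] -/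
theorem nonneg_of_window (r : LatticeRep G) {a : ℝ → ℝ} {sch : SpeciesScheme (YMSpecies G)} (hsch : IsLegScheme a sch)
    {φ : ℕ → ℕ} (hφ : Tendsto φ atTop atTop) {u θ B : ℝ} (hu : 0 < u) (hθ : 0 < θ) (hθ1 : θ < 1)
    (hwin : ∀ᶠ k in atTop, ∀ t : ℕ, u * (1 - θ) ≤ 2 * t * sch.a (φ k) → 2 * t * sch.a (φ k) ≤ u * (1 + θ) →
      ((2 * t : ℕ) : ℝ) ^ 8 * latticeConnectedCorr r.ρ (sch.β (φ k)) (2 * sch.L (φ k) + 1)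
        r.curvature.timeReflect.F r.curvature.F (2 * t) ≤ B) :
    0 ≤ B := by
  by_contra hB0
  have hBneg : B < 0 := not_le.1 hB0
  obtain ⟨-, -, hranges⟩ := hsch
  have ha0' : Tendsto (fun k => sch.a (φ k)) atTop (𝓝 0) := sch.tendsto_a.comp hφ
  have h1θ : 0 < 1 - θ := by linarith
  have hε : 0 < min (u * θ) (1 / (u + 2)) := lt_min (mul_pos hu hθ) (by positivity)
  obtain ⟨k, hwk, hka⟩ := (hwin.and (ha0'.eventually (gt_mem_nhds hε))).exists
  have hak : 0 < sch.a (φ k) := sch.a_pos _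
  have ha1 : sch.a (φ k) ≤ u * θ := hka.le.trans (min_le_left _ _)
  have ha2 : sch.a (φ k) ≤ 1 / (u + 2) := hka.le.trans (min_le_right _ _)
  obtain ⟨hβk, -, -, hLa⟩ := hranges (φ k)
  -- the lattice time `t = ⌈u(1−θ)/(2a)⌉`
  set t : ℕ := ⌈u * (1 - θ) / (2 * sch.a (φ k))⌉₊ with ht
  have htlo : u * (1 - θ) / (2 * sch.a (φ k)) ≤ t := Nat.le_ceil _
  have hthi : (t : ℝ) < u * (1 - θ) / (2 * sch.a (φ k)) + 1 := Nat.ceil_lt_add_one (by positivity)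
  have hlo' : u * (1 - θ) ≤ 2 * (t : ℝ) * sch.a (φ k) := by
    have := (div_le_iff₀ (by positivity : (0 : ℝ) < 2 * sch.a (φ k))).1 htlo
    linarith
  have hhi' : 2 * (t : ℝ) * sch.a (φ k) < u * (1 - θ) + 2 * sch.a (φ k) := by
    have := mul_lt_mul_of_pos_right hthi (by positivity : (0 : ℝ) < 2 * sch.a (φ k))
    rw [add_mul, div_mul_cancel₀ _ (by positivity : (2 : ℝ) * sch.a (φ k) ≠ 0), one_mul] at this
    linarith
  have hw2 : 2 * (t : ℝ) * sch.a (φ k) ≤ u * (1 + θ) := by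
    have e : u * (1 + θ) = u * (1 - θ) + 2 * (u * θ) := by ring
    rw [e]; linarith
  have ht2L : t + 2 ≤ sch.L (φ k) := by
    -- `2 t a ≤ 2u`, and `u/a + 2 ≤ a⁻² ≤ L` since `a (u + 2) ≤ 1`
    have h3 : sch.a (φ k) * (u + 2) ≤ 1 := by
      have := ha2; rw [le_div_iff₀ (by positivity)] at this; linarith
    have h4 : (t : ℝ) * sch.a (φ k) ≤ u := by
      have e : u * (1 - θ) + 2 * sch.a (φ k) ≤ 2 * u := by nlinarith [mul_pos hu hθ, ha1]
      linarith
    have key : ((t : ℝ) + 2) * (sch.a (φ k) * sch.a (φ k)) ≤ 1 := by nlinarith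
    have h5 : (t : ℝ) + 2 ≤ (sch.a (φ k))⁻¹ * (sch.a (φ k))⁻¹ := by
      rw [← mul_inv, inv_eq_one_div, le_div_iff₀ (by positivity)]
      exact key
    have : (t : ℝ) + 2 ≤ (sch.L (φ k) : ℝ) := h5.trans hLa
    exact_mod_cast this
  have hax := hwk t hlo' hw2
  have hpos := (sq_mixedKernel_le_lcc_mul_lcc r hβk (sch.L (φ k)) t t ht2L ht2L (Pi.single 0 ((t : ℤ) + t)) (by simp)).1
  have h8 : (0 : ℝ) ≤ ((2 * t : ℕ) : ℝ) ^ 8 := by positivity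
  have : (0 : ℝ) ≤ ((2 * t : ℕ) : ℝ) ^ 8 *
      latticeConnectedCorr r.ρ (sch.β (φ k)) (2 * sch.L (φ k) + 1) r.curvature.timeReflect.F r.curvature.F (2 * t) :=
    mul_nonneg h8 hpos
  linarith

/-- **The local density bound at `u e₀` from the window** (`B ≥ 0`): for every compactly supported test function whose difference variable stays in
the ball of radius `θu/2` about `u e₀`, `‖S₁ 2 F‖ ≤ B/(u(1−θ))⁸ · ∫‖F‖` — through the MIXED two-point sums (✓`tendsto_mixed_of_offDiagLimitAlong`)
and axis domination of the mixed kernel (✓`sq_mixedKernel_le_lcc_mul_lcc`). [cite: OsterwalderSeiler1978, §2] -/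
theorem norm_two_le_local_of_window (r : LatticeRep G) {a : ℝ → ℝ} (hMB : MomentBounds6 G r a)
    {sch : SpeciesScheme (YMSpecies G)} (hsch : IsLegScheme a sch) {φ : ℕ → ℕ} (hφ : Tendsto φ atTop atTop)
    {S₁ : SchwingerFamily E4} (hS₁ : OffDiagLimitAlong r sch φ S₁) {u θ B : ℝ} (hu : 0 < u) (hθ : 0 < θ) (hθ1 : θ < 1) (hB0 : 0 ≤ B)
    (hwin : ∀ᶠ k in atTop, ∀ t : ℕ, u * (1 - θ) ≤ 2 * t * sch.a (φ k) → 2 * t * sch.a (φ k) ≤ u * (1 + θ) →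
      ((2 * t : ℕ) : ℝ) ^ 8 * latticeConnectedCorr r.ρ (sch.β (φ k)) (2 * sch.L (φ k) + 1)
        r.curvature.timeReflect.F r.curvature.F (2 * t) ≤ B)
    (F : 𝓢((Fin 2 → E4), ℂ)) (hFc : HasCompactSupport (F : (Fin 2 → E4) → ℂ))
    (hFs : tsupport (F : (Fin 2 → E4) → ℂ) ⊆ {y | y 0 - y 1 ∈ closedBall (EuclideanSpace.single (0 : Fin 4) u) (θ * u / 2)}) :
    ‖S₁ 2 F‖ ≤ B / (u * (1 - θ)) ^ 8 * ∫ x, ‖F x‖ := by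
  classical
  have hsch' := hsch
  obtain ⟨-, -, hranges⟩ := hsch
  set as : ℕ → ℝ := fun k => sch.a (φ k) with has
  set βs : ℕ → ℝ := fun k => sch.β (φ k) with hβs
  set Ls : ℕ → ℕ := fun k => sch.L (φ k) with hLs
  have hapos' : ∀ k, 0 < as k := fun k => sch.a_pos _
  have ha0' : Tendsto as atTop (𝓝 0) := sch.tendsto_a.comp hφ
  have haL : Tendsto (fun k => as k * (Ls k : ℝ)) atTop atTop := sch.tendsto_L.comp hφ
  have h1θ : 0 < 1 - θ := by linarith
  have huθ : 0 < u * (1 - θ) := mul_pos hu h1θ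
  set ρ : ℝ := θ * u / 2 with hρ
  have hρ0 : 0 < ρ := by positivity
  set B' : ℝ := B / (u * (1 - θ)) ^ 8 with hB'
  have hB'0 : 0 ≤ B' := div_nonneg hB0 (pow_nonneg huθ.le 8)
  -- difference vectors on the support have time component `≥ u − ρ > 0`; in particular `F` is off-diagonal
  have htime_of_mem : ∀ y ∈ tsupport (F : (Fin 2 → E4) → ℂ), u - ρ ≤ (y 0 - y 1) 0 := by
    intro y hy
    have h1 : ‖y 0 - y 1 - EuclideanSpace.single 0 u‖ ≤ ρ := by
      have := hFs hy; rwa [mem_setOf_eq, mem_closedBall, dist_eq_norm] at this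
    have h2 := (PiLp.norm_apply_le (y 0 - y 1 - EuclideanSpace.single (0 : Fin 4) u) 0).trans h1
    rw [Real.norm_eq_abs, PiLp.sub_apply, PiLp.single_apply, if_pos rfl] at h2
    have := (abs_le.1 h2).1
    linarith
  have hFoff : IsOffDiagonal F := by
    refine IsOffDiagonal.of_tsupport_subset fun y hy hco => ?_
    obtain ⟨i, j, hij, hyij⟩ := (mem_coincidenceLocus y).1 hco
    have h01 : y 0 = y 1 := by
      fin_cases i <;> fin_cases j
      · exact absurd rfl hij
      · exact hyij
      · exact hyij.symm
      · exact absurd rfl hij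
    have h := htime_of_mem y hy
    rw [h01, sub_self, PiLp.zero_apply] at h
    have hρu : ρ < u := by
      rw [hρ]; have : θ * u < 1 * u := mul_lt_mul_of_pos_right hθ1 hu; linarith
    linarith
  -- the two limits: mixed sums → `S₁ 2 F`, Riemann sums → `∫ ‖F‖`
  have hlim := (tendsto_mixed_of_offDiagLimitAlong r hMB hsch' hφ hS₁ F hFoff hFc).norm
  have hRiem : Tendsto (fun k => as k ^ (4 * 2) *
      ∑ x ∈ Fintype.piFinset (fun _ : Fin 2 => box 4 (Ls k)), ‖F (fun i => as k • siteToE (x i))‖)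
      atTop (𝓝 (∫ y, ‖F y‖)) :=
    tendsto_riemann_sum (fun y => ‖F y‖) F.continuous.norm hFc.norm as Ls hapos' ha0' haL
  -- eventual domination
  have hε : 0 < min (θ * u / 2) (min (u / 6) (1 / (2 * u))) :=
    lt_min hρ0 (lt_min (by positivity) (by positivity))
  have hev : ∀ᶠ k in atTop, ‖∑ z ∈ Fintype.piFinset (fun _ : Fin 2 => box 4 (sch.L (φ k))),
      ((torusE G r (sch.β (φ k)) (sch.L (φ k))
            (fun V => dens G r (z 0) V * dens G r (siteReflect (z 1)) (cfgReflect V)) -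
          torusE G r (sch.β (φ k)) (sch.L (φ k)) (dens G r (z 0)) *
            torusE G r (sch.β (φ k)) (sch.L (φ k)) (dens G r (siteReflect (z 1))) : ℝ) : ℂ) *
        F (fun l => sch.a (φ k) • siteToE (z l))‖ ≤
      B' * (as k ^ (4 * 2) * ∑ x ∈ Fintype.piFinset (fun _ : Fin 2 => box 4 (Ls k)), ‖F (fun i => as k • siteToE (x i))‖) := by
    filter_upwards [hwin, ha0'.eventually (gt_mem_nhds hε)] with k hwk hka
    have hak : 0 < as k := hapos' k
    have ha1 : as k ≤ θ * u / 2 := hka.le.trans (min_le_left _ _)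
    have ha2 : as k ≤ u / 6 := (hka.le.trans (min_le_right _ _)).trans (min_le_left _ _)
    have ha3 : as k ≤ 1 / (2 * u) := (hka.le.trans (min_le_right _ _)).trans (min_le_right _ _)
    obtain ⟨hβk, -, hL14, hLa⟩ := hranges (φ k)
    -- the mixed weight at the lattice pairs seen by `F`
    have hW : ∀ x : Fin 2 → Site 4, F (fun i => as k • siteToE (x i)) ≠ 0 →
        |torusE G r (βs k) (Ls k) (fun V => dens G r (x 0) V * dens G r (siteReflect (x 1)) (cfgReflect V)) -
            torusE G r (βs k) (Ls k) (dens G r (x 0)) * torusE G r (βs k) (Ls k) (dens G r (siteReflect (x 1)))| ≤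
          B' * as k ^ (4 * 2) := by
      intro x hx
      have hy : (fun i => as k • siteToE (x i)) ∈ tsupport (F : (Fin 2 → E4) → ℂ) :=
        subset_tsupport _ (Function.mem_support.2 hx)
      -- `|a_k (x₀ − x₁)₀ − u| ≤ ρ`
      have hzt : |as k * (((x 0 - x 1) 0 : ℤ) : ℝ) - u| ≤ ρ := by
        have h1 : ‖as k • siteToE (x 0) - as k • siteToE (x 1) - EuclideanSpace.single 0 u‖ ≤ ρ := by
          have := hFs hy; rwa [mem_setOf_eq, mem_closedBall, dist_eq_norm] at this
        have h2 := (PiLp.norm_apply_le (as k • siteToE (x 0) - as k • siteToE (x 1) - EuclideanSpace.single (0 : Fin 4) u) 0).trans h1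
        rwa [Real.norm_eq_abs, smul_siteToE_sub_sub_single_apply_zero] at h2
      obtain ⟨hzl, hzu⟩ := abs_le.1 hzt
      -- `(x₀ − x₁)₀ = n ∈ ℕ`, `3 ≤ n ≤ L_k`
      have hz0pos : (0 : ℝ) < (((x 0 - x 1) 0 : ℤ) : ℝ) := by
        by_contra h
        have h' : as k * (((x 0 - x 1) 0 : ℤ) : ℝ) ≤ 0 := mul_nonpos_of_nonneg_of_nonpos hak.le (not_lt.1 h)
        linarith
      have hz0nn : 0 ≤ (x 0 - x 1) 0 := by exact_mod_cast hz0pos.le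
      obtain ⟨n, hn⟩ : ∃ n : ℕ, (x 0 - x 1) 0 = n := ⟨((x 0 - x 1) 0).toNat, (Int.toNat_of_nonneg hz0nn).symm⟩
      have hnr : (((x 0 - x 1) 0 : ℤ) : ℝ) = (n : ℝ) := by rw [hn]; rfl
      rw [hnr] at hzl hzu hz0pos
      have hn3 : 3 ≤ n := by
        have : (2 : ℝ) < n := by
          by_contra hc
          have hc' : (n : ℝ) ≤ 2 := not_lt.1 hc
          have : as k * n ≤ as k * 2 := mul_le_mul_of_nonneg_left hc' hak.le
          linarith
        exact_mod_cast this
      have hnL : n ≤ Ls k := by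
        have h2 : (n : ℝ) * as k ≤ 2 * u := by linarith
        have h3 : 2 * u * as k ≤ 1 := by
          have := ha3; rw [le_div_iff₀ (by positivity)] at this; linarith
        have key : (n : ℝ) * (as k * as k) ≤ 1 := by nlinarith
        have h5 : (n : ℝ) ≤ (as k)⁻¹ * (as k)⁻¹ := by
          rw [← mul_inv, inv_eq_one_div, le_div_iff₀ (by positivity)]
          exact key
        have : (n : ℝ) ≤ (Ls k : ℝ) := h5.trans hLa
        exact_mod_cast this
      -- the two window times `2⌈n/2⌉`, `2⌊n/2⌋ ∈ [n−1, n+1]`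
      have hwindow : ∀ t : ℕ, n - 1 ≤ 2 * t → 2 * t ≤ n + 1 →
          u * (1 - θ) ≤ 2 * t * sch.a (φ k) ∧ 2 * t * sch.a (φ k) ≤ u * (1 + θ) := by
        intro t ht1 ht2
        have ht1' : (n : ℝ) - 1 ≤ ((2 * t : ℕ) : ℝ) := by
          have h' : ((n - 1 : ℕ) : ℝ) ≤ ((2 * t : ℕ) : ℝ) := by exact_mod_cast ht1
          rwa [Nat.cast_sub (by omega), Nat.cast_one] at h'
        have ht2' : ((2 * t : ℕ) : ℝ) ≤ (n : ℝ) + 1 := by exact_mod_cast ht2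
        have hc : ((2 * t : ℕ) : ℝ) = 2 * (t : ℝ) := by push_cast; ring
        rw [hc] at ht1' ht2'
        have e1 : 2 * (t : ℝ) * sch.a (φ k) = as k * (2 * (t : ℝ)) := by rw [has]; ring
        constructor
        · have h5 : as k * ((n : ℝ) - 1) ≤ as k * (2 * (t : ℝ)) := mul_le_mul_of_nonneg_left ht1' hak.le
          have e2 : as k * ((n : ℝ) - 1) = as k * n - as k := by ring
          rw [e1]; linarith
        · have h5 : as k * (2 * (t : ℝ)) ≤ as k * ((n : ℝ) + 1) := mul_le_mul_of_nonneg_left ht2' hak.le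
          have e2 : as k * ((n : ℝ) + 1) = as k * n + as k := by ring
          have e3 : u * (1 + θ) = u + 2 * (θ * u / 2) := by ring
          rw [e1]; linarith
      obtain ⟨hl1, hu1⟩ := hwindow ((n + 1) / 2) (by omega) (by omega)
      obtain ⟨hl2, hu2⟩ := hwindow (n / 2) (by omega) (by omega)
      have hw1 := hwk ((n + 1) / 2) hl1 hu1
      have hw2 := hwk (n / 2) hl2 hu2
      have hcov := abs_mixedWeight_le_of_window r hβk hL14 x n hn hn3 hnL hB0 hw1 hw2
      refine hcov.trans ?_
      -- `B/(n−1)⁸ ≤ B' a_k⁸` since `a_k (n − 1) ≥ u(1−θ)`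
      have hm : u * (1 - θ) ≤ as k * ((n : ℝ) - 1) := by
        have e2 : as k * ((n : ℝ) - 1) = as k * n - as k := by ring
        have e3 : u * (1 - θ) = u - 2 * (θ * u / 2) := by ring
        rw [e2, e3]; linarith
      have hm0 : 0 < (n : ℝ) - 1 := by
        have : (3 : ℝ) ≤ n := by exact_mod_cast hn3
        linarith
      have hpow : (u * (1 - θ)) ^ 8 ≤ (as k * ((n : ℝ) - 1)) ^ 8 := pow_le_pow_left₀ huθ.le hm 8
      rw [show (4 * 2 : ℕ) = 8 by norm_num, hB', div_mul_eq_mul_div, div_le_div_iff₀ (pow_pos hm0 8) (pow_pos huθ 8)]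
      calc B * (u * (1 - θ)) ^ 8 ≤ B * (as k * ((n : ℝ) - 1)) ^ 8 := mul_le_mul_of_nonneg_left hpow hB0
        _ = B * as k ^ 8 * ((n : ℝ) - 1) ^ 8 := by ring
    -- sum over the torus
    refine (norm_sum_le _ _).trans ?_
    calc ∑ x ∈ Fintype.piFinset (fun _ : Fin 2 => box 4 (Ls k)),
          ‖((torusE G r (βs k) (Ls k) (fun V => dens G r (x 0) V * dens G r (siteReflect (x 1)) (cfgReflect V)) -
              torusE G r (βs k) (Ls k) (dens G r (x 0)) * torusE G r (βs k) (Ls k) (dens G r (siteReflect (x 1))) : ℝ) : ℂ) *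
            F (fun i => as k • siteToE (x i))‖
        ≤ ∑ x ∈ Fintype.piFinset (fun _ : Fin 2 => box 4 (Ls k)),
          B' * as k ^ (4 * 2) * ‖F (fun i => as k • siteToE (x i))‖ := by
          refine Finset.sum_le_sum fun x _ => ?_
          rw [norm_mul, Complex.norm_real, Real.norm_eq_abs]
          by_cases hx : F (fun i => as k • siteToE (x i)) = 0
          · simp [hx]
          · exact mul_le_mul_of_nonneg_right (hW x hx) (norm_nonneg _)
      _ = B' * (as k ^ (4 * 2) *
          ∑ x ∈ Fintype.piFinset (fun _ : Fin 2 => box 4 (Ls k)), ‖F (fun i => as k • siteToE (x i))‖) := by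
          rw [Finset.mul_sum, Finset.mul_sum]
          exact Finset.sum_congr rfl fun x _ => by ring
  exact le_of_tendsto_of_tendsto hlim (hRiem.const_mul _) hev

/-! ## §3 ★ `LatticeToAxis` in the skeleton's letter -/

/-- ★ **LATTICE TO AXIS** — the soft stub `LatticeToAxis` of the crux idea «rp-moebius-ladder» in the letter of the ideator sketch (single
axis order `(Q^θ, Q)` = the skeleton's `axisG`, unfolded; no sign hypothesis on `B`): under the door's hypotheses, if eventually along the
subsequence `(2t)⁸·lCC(Q^θ,Q,2t) ≤ B` for every lattice time `2t` with `2t·a_k ∈ [u(1−θ), u(1+θ)]`, then `u⁸ |K(u e₀)| ≤ (1+θ)⁸/(1−θ)⁸ · B`.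
[cite: OsterwalderSeiler1978, §2] -/
theorem latticeToAxis :
    ∀ (G : Type) [Group G] [TopologicalSpace G] [IsTopologicalGroup G] [CompactSpace G],
      IsCompactSimpleLieGroup G →
      letI : MeasurableSpace G := borel G
      haveI : BorelSpace G := ⟨rfl⟩
      ∀ (r : LatticeRep G) (a : ℝ → ℝ), (∀ β, 0 < a β) → Tendsto a atTop (nhds 0) → MomentBounds6 G r a →
        ∀ sch : SpeciesScheme (YMSpecies G), IsLegScheme a sch → ∀ φ : ℕ → ℕ, Tendsto φ atTop atTop →
        ∀ S₁ : SchwingerFamily E4, OffDiagLimitAlong r sch φ S₁ →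
        ∀ K : E4 → ℝ, ContinuousOn K {x : E4 | x ≠ 0} →
        (∀ F : 𝓢((Fin 2 → E4), ℂ), IsOffDiagonal F → HasCompactSupport (F : (Fin 2 → E4) → ℂ) →
          Integrable (fun x : Fin 2 → E4 => (K (x 0 - x 1) : ℂ) * F x) ∧
            S₁ 2 F = ∫ x : Fin 2 → E4, (K (x 0 - x 1) : ℂ) * F x) →
        ∀ (u θ B : ℝ), 0 < u → 0 < θ → θ < 1 →
          (∀ᶠ k in atTop, ∀ t : ℕ, u * (1 - θ) ≤ 2 * t * sch.a (φ k) → 2 * t * sch.a (φ k) ≤ u * (1 + θ) →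
            ((2 * t : ℕ) : ℝ) ^ 8 * latticeConnectedCorr r.ρ (sch.β (φ k)) (2 * sch.L (φ k) + 1)
                r.curvature.timeReflect.F r.curvature.F (2 * t) ≤ B) →
          u ^ 8 * |K (EuclideanSpace.single 0 u)| ≤ (1 + θ) ^ 8 / (1 - θ) ^ 8 * B := by
  intro G _ _ _ _ hG
  letI : MeasurableSpace G := borel G
  haveI : BorelSpace G := ⟨rfl⟩
  intro r a _ _ hMB sch hsch φ hφ S₁ hS₁ K hKc hrep u θ B hu hθ hθ1 hwin
  have hB0 : 0 ≤ B := nonneg_of_window r hsch hφ hu hθ hθ1 hwin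
  have h1θ : 0 < 1 - θ := by linarith
  have huθ : 0 < u * (1 - θ) := mul_pos hu h1θ
  have hρ0 : 0 < θ * u / 2 := by positivity
  have hx0 : (EuclideanSpace.single (0 : Fin 4) u : E4) ≠ 0 := by
    rw [Ne, PiLp.single_eq_zero_iff]; exact hu.ne'
  -- the local density bound and the local pointwise lemma
  have hK : |K (EuclideanSpace.single 0 u)| ≤ B / (u * (1 - θ)) ^ 8 :=
    abs_le_of_local_density_bound K hKc (S₁ 2) hrep hx0 hρ0
      (fun F hFc hFs => norm_two_le_local_of_window r hMB hsch hφ hS₁ hu hθ hθ1 hB0 hwin F hFc hFs)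
  -- constants
  have hfin : u ^ 8 * (B / (u * (1 - θ)) ^ 8) = B / (1 - θ) ^ 8 := by
    have hune : u ^ 8 ≠ 0 := pow_ne_zero 8 hu.ne'
    rw [mul_pow, mul_comm (u ^ 8) ((1 - θ) ^ 8), ← div_div, mul_div_assoc', mul_comm (u ^ 8), mul_div_assoc,
      div_self hune, mul_one]
  have h1θ8 : 0 < (1 - θ) ^ 8 := pow_pos h1θ 8
  calc u ^ 8 * |K (EuclideanSpace.single 0 u)| ≤ u ^ 8 * (B / (u * (1 - θ)) ^ 8) :=
        mul_le_mul_of_nonneg_left hK (pow_nonneg hu.le 8)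
    _ = B / (1 - θ) ^ 8 := hfin
    _ = 1 / (1 - θ) ^ 8 * B := by ring
    _ ≤ (1 + θ) ^ 8 / (1 - θ) ^ 8 * B := by
        refine mul_le_mul_of_nonneg_right (div_le_div_of_nonneg_right ?_ h1θ8.le) hB0
        exact one_le_pow₀ (by linarith)

end Summit.QuantumFields.YangMills.Theorems.F4SubCurvatureDoorSubCurvatureClauseLatticeToAxisSingle

end
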